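import Mathlib.NumberTheory.NumberField.Cyclotomic.Basic
import HarnessLib

/-!
# Weil-type family coverage — `(1 − η)⁴ = 5·(explicit unit)` for a primitive fifth root of unity `η`: `(1 − η)⁴·𝓞 K = 5·𝓞 K`
# (the prime element behind the SECOND ramified polarisation type at the census levels `35` and `45`)

research route conditional on HC_CM; not a corollary; Q11.4-sentence-2 already refuted in dim ≥ 3.

Ring 2, WEIL-TYPE FAMILY-COVERAGE CENSUS (`HOME/WEIL-FAMILY-COVERAGE.md` `## b01`, blocks b01.17 / b01.38; owner ring2-b01),
part 48d of the `Ring2WeilCoverage*` series — the `q = 5` companion of part 48c (`…RamifiedPrimePowers`: `q = 3, 4, 7, 9, 11`).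
At `M = 35` and `M = 45` BOTH ramified primes of `ℚ(ζ_M)⁺` are inert in `ℚ(ζ_M)` and flip the principal-polarisability
verdict; part 51 used the primes over `7` resp. `3`; the primes over `5` (`1 − ζ⁷` at `35`, `1 − ζ⁹` at `45`, primitive fifth
roots) give the second type, of norm `125`, whose polarised CM points lie on a NON-split component (part 52).  For any field
`K` and `η ∈ K` a primitive fifth root of unity:

* `one_sub_pow_eq_five`: **`(1 − η)⁴ = 5·W₅(η)`**, `W₅ = −η + η² − η³` (`(1 − x)⁴ − 5W₅(x) = Φ₅(x)`);
* `isUnit_W_five`: `W₅(η)` is a unit of `𝓞 K` (inverse `−1 − η + η³`);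
* **`span_one_sub_pow_eq_five`: `(1 − η)⁴·𝓞 K = 5·𝓞 K`**.

Certificates: `work/py/primepow.py`; re-verified by `linear_combination` from `Φ₅(η) = 0` (Mathlib
`IsPrimitiveRoot.geom_sum_eq_zero`).

HONEST FRAMING: elementary identities in `ℤ[η]`; nothing here mentions Hodge classes, polarisations, `W_K` or HC; `HC_CM` is
used nowhere.  No `def`, no named fact, no `sorry`.

References: [cite: Washington1997, Lemma 1.4 and Prop. 2.8]; census b01.17 (seat-derived).
-/

noncomputable section

open NumberField

namespace Summit.HodgeConjecture.Ring2WeilCoverage.RamifiedPrimePowerFive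

variable {K : Type} [Field K] {η : K}

/-- `Φ₅(η) = 0` for a primitive fifth root of unity. [folklore] -/
theorem rel_five (hη : IsPrimitiveRoot η 5) : 1 + η + η ^ 2 + η ^ 3 + η ^ 4 = 0 := by
  have h := hη.geom_sum_eq_zero (by norm_num)
  simpa [Finset.sum_range_succ] using h

/-- **`(1 − η)⁴ = 5·W₅(η)`**, `W₅ = −η + η² − η³`, for a primitive fifth root of unity `η` (`(1 − x)⁴ − 5W₅(x) = Φ₅(x)`).
research route conditional on HC_CM; not a corollary; Q11.4-sentence-2 already refuted in dim ≥ 3. [cite: Washington1997, Lemma 1.4] -/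
theorem one_sub_pow_eq_five (hη : IsPrimitiveRoot η 5) : (1 - η) ^ 4 = 5 * (-η + η ^ 2 - η ^ 3) := by
  linear_combination rel_five hη

/-- `W₅(η) = −η + η² − η³` is a unit of `𝓞 K` (inverse `−1 − η + η³`). [folklore] -/
theorem isUnit_W_five (hη : IsPrimitiveRoot η 5) :
    IsUnit (-hη.toInteger + hη.toInteger ^ 2 - hη.toInteger ^ 3 : 𝓞 K) := by
  have hzK : algebraMap (𝓞 K) K hη.toInteger = η := rfl
  refine IsUnit.of_mul_eq_one (-1 - hη.toInteger + hη.toInteger ^ 3) (RingOfIntegers.ext ?_)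
  push_cast; simp only [hzK]
  linear_combination (-1 + 2 * η - η ^ 2) * rel_five hη

/-- **`(1 − η)⁴·𝓞 K = 5·𝓞 K`** for a primitive fifth root of unity `η ∈ K`.
research route conditional on HC_CM; not a corollary; Q11.4-sentence-2 already refuted in dim ≥ 3. [cite: Washington1997, Lemma 1.4] -/
theorem span_one_sub_pow_eq_five (hη : IsPrimitiveRoot η 5) :
    Ideal.span {(1 - hη.toInteger : 𝓞 K)} ^ 4 = Ideal.span {(5 : 𝓞 K)} := by
  have hzK : algebraMap (𝓞 K) K hη.toInteger = η := rfl
  have h : (1 - hη.toInteger : 𝓞 K) ^ 4 = 5 * (-hη.toInteger + hη.toInteger ^ 2 - hη.toInteger ^ 3) :=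
    RingOfIntegers.ext (by push_cast; simp only [hzK, map_ofNat]; exact one_sub_pow_eq_five hη)
  rw [Ideal.span_singleton_pow, h, Ideal.span_singleton_mul_right_unit (isUnit_W_five hη)]

end Summit.HodgeConjecture.Ring2WeilCoverage.RamifiedPrimePowerFive

end
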